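import Mathlib.Analysis.Calculus.ParametricIntegral
import Mathlib.MeasureTheory.Integral.Bochner.ContinuousLinearMap
import Literature.Barriers.CriticalPhenomena.RigorousRGSmallParameterTphiCalculus
import HarnessLib

/-!
# `RigorousRGSmallParameter` (Slade, Theorem 1.4.1): the `T_φ` seminorm of [BS-rg-norm] —
# VI. Translation and expectation: `‖θ_ζF‖_{T_φ} = ‖F‖_{T_{φ+ζ}}` and
# `‖E θF‖_{T_φ} ≤ E‖F‖_{T_{φ+ξ}}` (BBS Proposition 10.3.1; [BS-rg-norm] Proposition 3.8.2, bosonic)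

Sequel of `RigorousRGSmallParameterTphiCalculus.lean` (abstract `E`, `e : Ξ → E`, any family of
test functionals). The renormalisation-group map acts on `𝒩` through the Gaussian convolution
`(E_Cθ F)(φ) = E_C F(φ + ζ)` (Slade §4.1; in the tree `thetaConv`/`progressive` of
`RigorousRGSmallParameterGaussianIntegration.lean`), and the basic analytic fact making the
`T_φ` seminorm useful is the analogue of `|∫f| ≤ ∫|f|` ([BS-rg-norm] §3.1): Bauerschmidt–Brydges–
Slade, *Introduction to a renormalisation group method* (LNM 2242, 2019), Proposition 10.3.1:
"`‖θ_ζ F‖_{T_φ} = ‖F‖_{T_{φ+ζ}}`" and "`‖E_C F_ζ‖_{T_φ} ≤ E_C‖F_ζ‖_{T_φ}`" ("obtained by commuting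
derivatives past the expectation … and then the desired result follows from the definition of
the `T_φ`-seminorm"); Brydges–Slade [BS-rg-norm], Proposition 3.8.2, second display (bosonic
part): `‖E_C θF‖_{T_φ(w)} ≤ E_{C_b}‖F‖_{T_{φ+ξ}(w+w')}` (here with `w' = 0`).

## What this file proves (everything; no named fact)

* `translate` (`θ_ζ`), `coeff_translate` (`(θ_ζF)_z = θ_ζ(F_z)`), **`TphiNorm_translate`**;
* **`Tnorm_integral_le`** — convexity of the `T`-seminorm of file I under averaging of
  coefficient families: `‖∫F_ξ dμ‖_T ≤ ∫ m dμ` for any integrable majorant `m(ξ) ≥ ‖F_ξ‖_T`;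
* `fderiv_coeff_apply`, `abs_coeff_le`, `norm_fderiv_coeff_le` (coefficients and their
  derivatives against `‖D^kF‖`), **`coeff_integral_translate`** — differentiation under the
  integral sign: `(θ_μF)_z(φ) = ∫F_z(φ+ξ)dμ(ξ)` for `F` with bounded derivatives of all orders and
  a finite measure `μ` (Mathlib's `hasFDerivAt_integral_of_dominated_of_fderiv_le`, iterated);
* **`TphiNorm_integral_translate_le`** — `‖θ_μF‖_{T_φ} ≤ ∫ m dμ` for any integrable majorant
  `m(ξ) ≥ ‖F‖_{T_{φ+ξ}}` (the printed `E_C‖F‖_{T_{φ+ζ}}` being the case `m = ‖F‖_{T_{φ+·}}`; the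
  majorant form is the one used with regulators, `m = ‖F‖_G · G(X, φ+ξ)`).

Hypotheses: `E` a real normed space with its Borel σ-algebra, second countable (fields on a finite
torus are finite-dimensional), `μ` finite (the Gaussian `E_C` is a probability measure), `F`
smooth with bounded derivatives of all orders (as `e^{-V}`-type integrands). Ledger effect: none on
the trust base of the barrier's reduction chain (`Slade2017_prop822`).
-/

noncomputable section

namespace Literature.Barriers.CriticalPhenomena

namespace LongRangePhi4

namespace Tphi

open Finset MeasureTheory
open scoped ContDiff

variable {Ξ : Type*}
variable {E : Type*} [NormedAddCommGroup E] [NormedSpace ℝ E]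

/-! ### Translation: `‖θ_ζ F‖_{T_φ} = ‖F‖_{T_{φ+ζ}}` -/

/-- The translate `(θ_ζ F)(φ) = F(φ + ζ)`. [cite: BauerschmidtBrydgesSlade2019RG, Proposition 10.3.1 (definition of θ_ζ F)] -/
def translate (ζ : E) (F : E → ℝ) : E → ℝ := fun φ => F (φ + ζ)

/-- Translates of smooth functions are smooth. [folklore] -/
theorem contDiff_translate (ζ : E) {F : E → ℝ} (hF : ContDiff ℝ ∞ F) : ContDiff ℝ ∞ (translate ζ F) :=
  hF.comp (contDiff_id.add contDiff_const)

/-- `∂_v(θ_ζF) = θ_ζ(∂_vF)` ("commuting derivatives with the translation"). [cite: BauerschmidtBrydgesSlade2019RG, Proposition 10.3.1 (proof of (10.3.1))] -/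
theorem dirDeriv_translate (ζ v : E) (F : E → ℝ) : dirDeriv v (translate ζ F) = translate ζ (dirDeriv v F) := by
  funext φ
  show fderiv ℝ (fun φ => F (φ + ζ)) φ v = fderiv ℝ F (φ + ζ) v
  rw [fderiv_comp_add_right]

/-- **Coefficients commute with translation**: `(θ_ζF)_z(φ) = F_z(φ+ζ)`. [cite: BauerschmidtBrydgesSlade2019RG, Proposition 10.3.1 ((10.3.1) and its proof)] -/
theorem coeff_translate (e : Ξ → E) (ζ : E) (F : E → ℝ) :
    ∀ z : List Ξ, coeff e z (translate ζ F) = translate ζ (coeff e z F)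
  | [] => rfl
  | a :: z => by rw [coeff_cons, coeff_cons, coeff_translate e ζ F z, dirDeriv_translate]

variable [Fintype Ξ]

/-- **BBS Proposition 10.3.1, first part: `‖θ_ζF‖_{T_φ} = ‖F‖_{T_{φ+ζ}}`** (for every family of
test functionals). [cite: BauerschmidtBrydgesSlade2019RG, Proposition 10.3.1 (display ‖θ_ζF‖_{T_φ} = ‖F‖_{T_{φ+ζ}})] -/
theorem TphiNorm_translate (pN : ℕ) (𝓛 : Set (TestFunctional Ξ)) (e : Ξ → E) (ζ : E) (F : E → ℝ)
    (φ : E) : TphiNorm pN 𝓛 e (translate ζ F) φ = TphiNorm pN 𝓛 e F (φ + ζ) := by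
  unfold TphiNorm coeffFamily
  congr 1
  funext z
  rw [coeff_translate]
  rfl

/-! ### Convexity: the `T`-seminorm of an integral of coefficient families -/

variable {Ω : Type*} [MeasurableSpace Ω]

/-- **`‖∫ F_ξ dμ‖_T ≤ ∫ m dμ`** whenever `‖F_ξ‖_T ≤ m(ξ)`: the `T`-seminorm of an average of
coefficient families is at most the average of (a majorant of) the seminorms — the pairing is
linear, `|∫| ≤ ∫|·|`, and the supremum over the unit ball is taken last.
[cite: BauerschmidtBrydgesSlade2019RG, Proposition 10.3.1 (proof of (10.3.2): "commuting derivatives past the expectation")] -/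
theorem Tnorm_integral_le {pN : ℕ} {𝓛 : Set (TestFunctional Ξ)} {C : ℕ → ℝ} (hC : EvalBound pN 𝓛 C)
    (μ : Measure Ω) (Fam : Ω → List Ξ → ℝ) (hint : ∀ z : List Ξ, z.length ≤ pN → Integrable (fun ξ => Fam ξ z) μ)
    {m : Ω → ℝ} (hm : Integrable m μ) (hle : ∀ ξ, Tnorm pN 𝓛 (Fam ξ) ≤ m ξ) :
    Tnorm pN 𝓛 (fun z => ∫ ξ, Fam ξ z ∂μ) ≤ ∫ ξ, m ξ ∂μ := by
  refine Tnorm_le fun g hg => ?_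
  -- the pairing of the averaged family is the average of the pairings
  have hlin : pairing pN (fun z => ∫ ξ, Fam ξ z ∂μ) g = ∫ ξ, pairing pN (Fam ξ) g ∂μ := by
    unfold pairing
    rw [integral_finsetSum _ (fun r hr => ?_)]
    · refine Finset.sum_congr rfl fun r hr => ?_
      rw [Finset.mem_range] at hr
      rw [integral_const_mul]
      congr 1
      -- `sumSeq` commutes with the integral (finite sums)
      have hss : ∀ (k : ℕ) (f : Ω → List Ξ → ℝ), (∀ z : List Ξ, z.length = k → Integrable (fun ξ => f ξ z) μ) →
          sumSeq k (fun z => ∫ ξ, f ξ z ∂μ) = ∫ ξ, sumSeq k (fun z => f ξ z) ∂μ := by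
        intro k
        induction k with
        | zero => intro f _; rfl
        | succ k ih =>
          intro f hf
          simp only [sumSeq_succ]
          rw [integral_finsetSum _ (fun a _ => ?_)]
          · refine Finset.sum_congr rfl fun a _ => ih (fun ξ z => f ξ (a :: z)) (fun z hz => hf _ (by simp [hz]))
          · exact integrable_sumSeq k _ (fun z hz => hf _ (by simp [hz]))
      rw [← hss r (fun ξ z => Fam ξ z * g z) (fun z hz => (hint z (by omega)).mul_const _)]
      refine sumSeq_congr r fun z hz => ?_
      show (∫ ξ, Fam ξ z ∂μ) * g z = ∫ ξ, Fam ξ z * g z ∂μ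
      rw [integral_mul_const]
    · rw [Finset.mem_range] at hr
      exact (integrable_sumSeq r _ (fun z hz => (hint z (by omega)).mul_const _)).const_mul _
  rw [hlin]
  calc |∫ ξ, pairing pN (Fam ξ) g ∂μ| ≤ ∫ ξ, |pairing pN (Fam ξ) g| ∂μ := by
        rw [← Real.norm_eq_abs]; exact norm_integral_le_integral_norm _ |>.trans (by simp [Real.norm_eq_abs])
    _ ≤ ∫ ξ, m ξ ∂μ := by
        refine integral_mono_of_nonneg (Filter.Eventually.of_forall fun ξ => abs_nonneg _) hm
          (Filter.Eventually.of_forall fun ξ => (abs_pairing_le_Tnorm hC _ hg).trans (hle ξ))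
where
  /-- `sumSeq` of integrable summands is integrable. [folklore] -/
  integrable_sumSeq : ∀ (k : ℕ) (f : Ω → List Ξ → ℝ), (∀ z : List Ξ, z.length = k → Integrable (fun ξ => f ξ z) μ) →
      Integrable (fun ξ => sumSeq k (fun z => f ξ z)) μ := by
    intro k
    induction k with
    | zero => intro f hf; simpa using hf [] rfl
    | succ k ih =>
      intro f hf
      simp only [sumSeq_succ]
      exact integrable_finsetSum _ fun a _ => ih (fun ξ z => f ξ (a :: z)) (fun z hz => hf _ (by simp [hz]))

/-! ### Differentiation under the integral: coefficients of `θ_μF(φ) = ∫ F(φ+ξ) dμ(ξ)` -/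

section interchange

omit [Fintype Ξ] in
/-- The derivative of a coefficient in an arbitrary direction is the next mixed derivative:
`D(F_z)(ψ)w = D^{|z|+1}F(ψ)(w, e_{z_1}, …, e_{z_p})`. [folklore] -/
theorem fderiv_coeff_apply (e : Ξ → E) {F : E → ℝ} (hF : ContDiff ℝ ∞ F) (z : List Ξ) (ψ w : E) :
    fderiv ℝ (coeff e z F) ψ w = iteratedFDeriv ℝ (z.length + 1) F ψ (Fin.cons w fun i => e (z.get i)) := by
  have ih : coeff e z F = fun ψ => iteratedFDeriv ℝ z.length F ψ (fun i => e (z.get i)) :=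
    funext fun ψ => coeff_eq_iteratedFDeriv e hF z ψ
  rw [ih]
  have hd : DifferentiableAt ℝ (iteratedFDeriv ℝ z.length F) ψ :=
    (hF.differentiable_iteratedFDeriv (WithTop.coe_lt_coe.2 (ENat.coe_lt_top _))) ψ
  have happ : HasFDerivAt (fun ψ => iteratedFDeriv ℝ z.length F ψ (fun i => e (z.get i)))
      ((ContinuousMultilinearMap.apply ℝ (fun _ : Fin z.length => E) ℝ (fun i => e (z.get i))).comp
        (fderiv ℝ (iteratedFDeriv ℝ z.length F) ψ)) ψ :=
    (ContinuousMultilinearMap.apply ℝ (fun _ : Fin z.length => E) ℝ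
      (fun i => e (z.get i))).hasFDerivAt.comp ψ hd.hasFDerivAt
  rw [happ.fderiv, ContinuousLinearMap.comp_apply, ContinuousMultilinearMap.apply_apply,
    iteratedFDeriv_succ_apply_left]
  rfl

omit [Fintype Ξ] in
/-- `|F_z(ψ)| ≤ ‖D^{|z|}F(ψ)‖ ∏_k ‖e_{z_k}‖`. [folklore] -/
theorem abs_coeff_le (e : Ξ → E) {F : E → ℝ} (hF : ContDiff ℝ ∞ F) (z : List Ξ) (ψ : E) :
    |coeff e z F ψ| ≤ ‖iteratedFDeriv ℝ z.length F ψ‖ * ∏ i : Fin z.length, ‖e (z.get i)‖ := by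
  rw [coeff_eq_iteratedFDeriv e hF z ψ, ← Real.norm_eq_abs]
  exact ContinuousMultilinearMap.le_opNorm _ _

omit [Fintype Ξ] in
/-- `‖D(F_z)(ψ)‖ ≤ ‖D^{|z|+1}F(ψ)‖ ∏_k ‖e_{z_k}‖`. [folklore] -/
theorem norm_fderiv_coeff_le (e : Ξ → E) {F : E → ℝ} (hF : ContDiff ℝ ∞ F) (z : List Ξ) (ψ : E) :
    ‖fderiv ℝ (coeff e z F) ψ‖ ≤ ‖iteratedFDeriv ℝ (z.length + 1) F ψ‖ * ∏ i : Fin z.length, ‖e (z.get i)‖ := by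
  refine ContinuousLinearMap.opNorm_le_bound _ (by positivity) fun w => ?_
  rw [fderiv_coeff_apply e hF z ψ w]
  refine (ContinuousMultilinearMap.le_opNorm _ _).trans (le_of_eq ?_)
  rw [Fin.prod_univ_succ]
  simp only [Fin.cons_zero, Fin.cons_succ]
  ring

variable [MeasurableSpace E] [BorelSpace E] [SecondCountableTopology E]

omit [Fintype Ξ] in
/-- **Differentiation under the integral sign for the coefficients**: if `F ∈ 𝒩` has bounded
derivatives of all orders and `μ` is a finite measure, then
`(θ_μF)_z(φ) = ∫ F_z(φ+ξ) dμ(ξ)` where `θ_μF(φ) = ∫ F(φ+ξ) dμ(ξ)` ("commuting derivatives past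
the expectation"). [cite: BauerschmidtBrydgesSlade2019RG, Proposition 10.3.1 (proof of (10.3.2))] -/
theorem coeff_integral_translate (μ : Measure E) [IsFiniteMeasure μ] (e : Ξ → E) {F : E → ℝ}
    (hF : ContDiff ℝ ∞ F) (hB : ∀ k : ℕ, ∃ B : ℝ, ∀ ψ, ‖iteratedFDeriv ℝ k F ψ‖ ≤ B) :
    ∀ z : List Ξ, coeff e z (fun φ => ∫ ξ, F (φ + ξ) ∂μ) = fun φ => ∫ ξ, coeff e z F (φ + ξ) ∂μ
  | [] => rfl
  | a :: z => by
      rw [coeff_cons, coeff_integral_translate μ e hF hB z]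
      funext φ
      set G := coeff e z F with hG
      have hGs : ContDiff ℝ ∞ G := contDiff_coeff e hF z
      have hGc : Continuous G := hGs.continuous
      have hGd : Differentiable ℝ G := differentiable_of_contDiff hGs
      have hGfc : Continuous (fderiv ℝ G) := hGs.continuous_fderiv (by simp)
      obtain ⟨B0, hB0⟩ := hB z.length
      obtain ⟨B1, hB1⟩ := hB (z.length + 1)
      set P : ℝ := ∏ i : Fin z.length, ‖e (z.get i)‖ with hP
      have hbd0 : ∀ ψ, ‖G ψ‖ ≤ B0 * P := fun ψ => by
        rw [Real.norm_eq_abs]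
        exact (abs_coeff_le e hF z ψ).trans (mul_le_mul_of_nonneg_right (hB0 ψ) (by positivity))
      have hbd1 : ∀ ψ, ‖fderiv ℝ G ψ‖ ≤ B1 * P := fun ψ =>
        (norm_fderiv_coeff_le e hF z ψ).trans (mul_le_mul_of_nonneg_right (hB1 ψ) (by positivity))
      have hmeas : ∀ x : E, AEStronglyMeasurable (fun ξ => G (x + ξ)) μ := fun x =>
        (hGc.comp (continuous_const.add continuous_id)).aestronglyMeasurable
      have hkey := hasFDerivAt_integral_of_dominated_of_fderiv_le (μ := μ) (x₀ := φ) (s := Set.univ)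
        (F := fun x ξ => G (x + ξ)) (F' := fun x ξ => fderiv ℝ G (x + ξ)) (bound := fun _ => B1 * P)
        Filter.univ_mem (Filter.Eventually.of_forall hmeas)
        ((integrable_const (B0 * P)).mono' (hmeas φ) (Filter.Eventually.of_forall fun ξ => hbd0 _))
        ((hGfc.comp (continuous_const.add continuous_id)).aestronglyMeasurable)
        (Filter.Eventually.of_forall fun ξ x _ => hbd1 _) (integrable_const _)
        (Filter.Eventually.of_forall fun ξ x _ => by
          have h := (hGd (x + ξ)).hasFDerivAt.comp x ((hasFDerivAt_id x).add_const ξ)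
          rw [ContinuousLinearMap.comp_id] at h
          exact h)
      have hint1 : Integrable (fun ξ => fderiv ℝ G (φ + ξ)) μ :=
        (integrable_const (B1 * P)).mono' ((hGfc.comp (continuous_const.add continuous_id)).aestronglyMeasurable)
          (Filter.Eventually.of_forall fun ξ => hbd1 _)
      simp only [dirDeriv]
      rw [hkey.fderiv, ContinuousLinearMap.integral_apply hint1]
      rfl

/-- **BBS Proposition 10.3.1, second part / [BS-rg-norm] Proposition 3.8.2 (bosonic, equal weights):
`‖θ_μ F‖_{T_φ} ≤ ∫ ‖F‖_{T_{φ+ξ}} dμ(ξ)`**, here in the form: for any integrable majorant `m` of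
`ξ ↦ ‖F‖_{T_{φ+ξ}}`, `‖θ_μF‖_{T_φ} ≤ ∫ m dμ` — for `F ∈ 𝒩` with bounded derivatives of all orders,
a finite measure `μ` (e.g. the Gaussian `E_C`), and any family of test functionals whose unit
ball is bounded on short sequences. [cite: BauerschmidtBrydgesSlade2019RG, Proposition 10.3.1 (display ‖E_C F_ζ‖_{T_φ} ≤ E_C‖F_ζ‖_{T_φ})] [cite: BrydgesSlade2015RGI, Proposition 3.8.2 (second display, bosonic part)] -/
theorem TphiNorm_integral_translate_le {pN : ℕ} {𝓛 : Set (TestFunctional Ξ)} {C : ℕ → ℝ}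
    (hC : EvalBound pN 𝓛 C) (μ : Measure E) [IsFiniteMeasure μ] (e : Ξ → E) {F : E → ℝ}
    (hF : ContDiff ℝ ∞ F) (hB : ∀ k : ℕ, ∃ B : ℝ, ∀ ψ, ‖iteratedFDeriv ℝ k F ψ‖ ≤ B) (φ : E)
    {m : E → ℝ} (hm : Integrable m μ) (hle : ∀ ξ, TphiNorm pN 𝓛 e F (φ + ξ) ≤ m ξ) :
    TphiNorm pN 𝓛 e (fun ψ => ∫ ξ, F (ψ + ξ) ∂μ) φ ≤ ∫ ξ, m ξ ∂μ := by
  unfold TphiNorm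
  have hfam : coeffFamily e (fun ψ => ∫ ξ, F (ψ + ξ) ∂μ) φ = fun z => ∫ ξ, coeffFamily e F (φ + ξ) z ∂μ := by
    funext z
    simp only [coeffFamily]
    rw [coeff_integral_translate μ e hF hB z]
  rw [hfam]
  refine Tnorm_integral_le hC μ (fun ξ z => coeffFamily e F (φ + ξ) z) (fun z _ => ?_) hm hle
  -- integrability of `ξ ↦ F_z(φ+ξ)`: bounded and continuous
  obtain ⟨B0, hB0⟩ := hB z.length
  have hGc : Continuous (coeff e z F) := (contDiff_coeff e hF z).continuous
  refine (integrable_const (B0 * ∏ i : Fin z.length, ‖e (z.get i)‖)).mono'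
    ((hGc.comp (continuous_const.add continuous_id)).aestronglyMeasurable)
    (Filter.Eventually.of_forall fun ξ => ?_)
  rw [Real.norm_eq_abs]
  exact (abs_coeff_le e hF z _).trans (mul_le_mul_of_nonneg_right (hB0 _) (by positivity))

end interchange

end Tphi

end LongRangePhi4

end Literature.Barriers.CriticalPhenomena

end
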